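import Literature.Probability.RandomPlanarGeometry.SAWEndpointKestenInequality
import Literature.Probability.RandomPlanarGeometry.SAWEndpointRatioLimit
import Literature.Probability.RandomPlanarGeometry.SAWEndpointSupermult
import Literature.Probability.RandomPlanarGeometry.SAWEndpointRateLower
import Literature.Probability.RandomPlanarGeometry.SAWEndpointRateUpper
import Literature.Probability.RandomPlanarGeometry.SAWKestenRatioExplicit
import HarnessLib

/-!
# Kesten's fixed-endpoint ratio rate (Madras–Slade (7.5.2)) on `ℤ²` for the neighbours of the origin

Topic `Literature/Probability/RandomPlanarGeometry` (assembles `SAWEndpointKestenInequality.lean` (Theorem 7.3.2(c) for the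
spliced family), `SAWEndpointRatioLimit.lean` (Lemma 7.3.3 instance, monotonicity in steps of two), `SAWEndpointSupermult.lean`
(polygon super-multiplicativity, neighbour symmetry), `SAWEndpointRateLower.lean` / `SAWEndpointRateUpper.lean` (the abstract
`1/3`- and `1/4`-rate lemmas), `SAWKestenRatioExplicit.lean` (Hammersley–Welsh envelope `KestenRate.count_le_envelope`)).

Source: N. Madras, G. Slade, *The Self-Avoiding Walk* (1993), §7.5 Notes, eq. (7.5.2) (p. 255; Kesten 1963): for the ratio of
Theorem 7.3.4(b), "`-K N^{-1/3} ≤ c_{N+2}(0,x)/c_N(0,x) − μ² ≤ K N^{-1/4}` for all sufficiently large `N` [of the parity of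
`‖x‖₁`]".  The tree types this as the NAMED FACT `Zd.Kesten1963_ratioRate_endpoint` (`SAWKestenRatioRate.lean`, all `d ≥ 2`,
all `x ≠ 0`).  THIS FILE PROVES ITS FIRST CASE: `d = 2`, `‖x‖₁ = 1` (the four neighbours of the origin, odd `N`), with `N₀ = 1`.

## What is here (namespace `Literature.Probability.RandomPlanarGeometry.SAW.Zd`; all proved, axioms standard)

* `EndpointRatio.kesten_ineq_all` — (7.3.3) for the spliced family for ALL `n ≥ 1` (constant `B ≥ max(1, μ²)`);
* `EndpointRatio.card_spliceW_le_exp`, `EndpointRatio.spliceW_supermul` — the envelope / super-multiplicativity inputs;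
* `EndpointRatio.rate_lower`, `EndpointRatio.rate_upper` — the two one-sided rates for `|spliceW (N+2)|/|spliceW N|`;
* **`Kesten1963_ratioRate_neighbour_two`** — (7.5.2) on `ℤ²` for `‖x‖₁ = 1`:
  `∀ x, ‖x‖₁ = 1 → ∃ K N₀, ∀ N ≥ N₀ odd, -K N^{-1/3} ≤ c_{N+2}(0,x)/c_N(0,x) − μ² ≤ K N^{-1/4}`.
-/

noncomputable section

open Filter Topology Finset Literature.Probability.LatticeModels Literature.Probability.Percolation SimpleGraph
open scoped BigOperators

namespace Literature.Probability.RandomPlanarGeometry.SAW.Zd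

namespace EndpointRatio

/-- **(7.3.3) for the spliced family, all `n ≥ 1`**: `φ_n − B/n ≤ φ_{n+2}` with `B ≥ max(1, μ²)` (from Theorem 7.3.2(a)/(c)
eventually, `φ_n ≥ 1` eventually, and a finite maximum over small `n`).
[cite: MadrasSlade1993, Lemma 7.3.1 (proof, eq. (7.3.3))] -/
theorem kesten_ineq_all : ∃ B : ℝ, 1 ≤ B ∧ connectiveConstant 2 ^ 2 ≤ B ∧ ∀ n : ℕ, 1 ≤ n →
    ((spliceW (n + 2)).card : ℝ) / (spliceW n).card - B / n ≤
      ((spliceW (n + 4)).card : ℝ) / (spliceW (n + 2)).card := by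
  classical
  obtain ⟨D, hD⟩ := thm732_spliceW
  obtain ⟨N₁, hN₁⟩ := eventually_atTop.1 hD
  have ha : ∀ n, (0 : ℝ) < (spliceW n).card := fun n => by exact_mod_cast card_spliceW_pos n
  set φ : ℕ → ℝ := fun n => ((spliceW (n + 2)).card : ℝ) / (spliceW n).card with hφ
  have hφpos : ∀ n, 0 < φ n := fun n => div_pos (ha _) (ha _)
  set D' : ℝ := max D 0 with hD'
  set N₂ : ℕ := max N₁ 9 with hN₂
  set B : ℝ := D' + connectiveConstant 2 ^ 2 + 1 + ∑ n ∈ Finset.range N₂, (n : ℝ) * φ n with hB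
  have hsum : 0 ≤ ∑ n ∈ Finset.range N₂, (n : ℝ) * φ n :=
    Finset.sum_nonneg fun n _ => mul_nonneg (Nat.cast_nonneg _) (hφpos n).le
  have hD'0 : 0 ≤ D' := le_max_right _ _
  have hμ2 : 0 ≤ connectiveConstant 2 ^ 2 := sq_nonneg _
  refine ⟨B, by rw [hB]; linarith, by rw [hB]; linarith, fun n hn => ?_⟩
  have hn0 : (0 : ℝ) < n := by exact_mod_cast hn
  have hB0 : 0 ≤ B := by rw [hB]; linarith
  show φ n - B / n ≤ φ (n + 2)
  rcases le_or_gt N₂ n with hbig | hsmall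
  · -- large `n`: Theorem 7.3.2 with `φ_n ≥ 1`
    have h1 : φ n ^ 2 - D / n ≤ φ n * φ (n + 2) := by
      have := hN₁ n (le_trans (le_max_left _ _) hbig)
      simpa [hφ, show n + 2 + 2 = n + 4 by ring] using this
    have hφ1 : 1 ≤ φ n := by
      show (1 : ℝ) ≤ ((spliceW (n + 2)).card : ℝ) / (spliceW n).card
      rw [le_div_iff₀ (ha n), one_mul]
      exact_mod_cast card_spliceW_le_add_two (le_trans (le_max_right _ _) hbig)
    have hDD : D ≤ B := by rw [hB]; linarith [le_max_left D 0]
    -- `φ (φ − B/n) ≤ φ² − B/n ≤ φ² − D/n ≤ φ φ₂`, divide by `φ > 0`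
    have h2 : φ n * (φ n - B / n) ≤ φ n * φ (n + 2) := by
      have h3 : B / n ≤ φ n * (B / n) := le_mul_of_one_le_left (div_nonneg hB0 hn0.le) hφ1
      have h4 : D / n ≤ B / n := div_le_div_of_nonneg_right hDD hn0.le
      nlinarith
    exact le_of_mul_le_mul_left h2 (hφpos n)
  · -- small `n`: `B ≥ n φ_n`
    have h1 : (n : ℝ) * φ n ≤ B := by
      have : (n : ℝ) * φ n ≤ ∑ m ∈ Finset.range N₂, (m : ℝ) * φ m :=
        Finset.single_le_sum (f := fun m : ℕ => (m : ℝ) * φ m) (fun m _ => mul_nonneg (Nat.cast_nonneg _) (hφpos m).le)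
          (Finset.mem_range.2 hsmall)
      rw [hB]; linarith
    have h2 : φ n ≤ B / n := by rw [le_div_iff₀ hn0]; linarith
    linarith [hφpos (n + 2)]

/-- The Hammersley–Welsh exponent is `O(√(n+1))`: `hwEnvelope μ n ≤ (2 + π + log μ) √(n+1)` for `μ ≥ 1`.
[cite: MadrasSlade1993, Theorem 3.1.1 (Hammersley–Welsh bound)] -/
theorem hwEnvelope_le {μ : ℝ} (hμ : 1 ≤ μ) (n : ℕ) :
    KestenRate.hwEnvelope μ n ≤ (2 + Real.pi + Real.log μ) * Real.sqrt ((n : ℝ) + 1) := by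
  unfold KestenRate.hwEnvelope
  have hn1 : (1 : ℝ) ≤ (n : ℝ) + 1 := by linarith [Nat.cast_nonneg (α := ℝ) n]
  have hs1 : 1 ≤ Real.sqrt ((n : ℝ) + 1) := Real.one_le_sqrt.2 hn1
  have hs0 : 0 < Real.sqrt ((n : ℝ) + 1) := by linarith
  -- `log(n+1) = 2 log √(n+1) ≤ 2 (√(n+1) − 1) ≤ 2 √(n+1)`
  have h1 : Real.log ((n : ℝ) + 1) ≤ 2 * Real.sqrt ((n : ℝ) + 1) := by
    have e : Real.log ((n : ℝ) + 1) = 2 * Real.log (Real.sqrt ((n : ℝ) + 1)) := by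
      rw [Real.log_sqrt (by linarith)]; ring
    rw [e]
    have := Real.log_le_sub_one_of_pos hs0
    linarith
  -- `π √(2(n+1)/3) ≤ π √(n+1)`
  have h2 : Real.pi * Real.sqrt (2 * ((n : ℝ) + 1) / 3) ≤ Real.pi * Real.sqrt ((n : ℝ) + 1) :=
    mul_le_mul_of_nonneg_left (Real.sqrt_le_sqrt (by linarith)) Real.pi_pos.le
  have h3 : Real.log μ ≤ Real.log μ * Real.sqrt ((n : ℝ) + 1) := le_mul_of_one_le_right (Real.log_nonneg hμ) hs1
  linarith

/-- **Upper envelope for the spliced family**: `|spliceW n| ≤ c_n ≤ e^{(2+π+log μ)√(n+1)} μ^n`.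
[cite: MadrasSlade1993, Theorem 3.1.1, eq. (1.2.17) (Hammersley–Welsh bound)] -/
theorem card_spliceW_le_exp (n : ℕ) : ((spliceW n).card : ℝ) ≤
    Real.exp ((2 + Real.pi + Real.log (connectiveConstant 2)) * Real.sqrt ((n : ℝ) + 1)) * connectiveConstant 2 ^ n := by
  have h1 : ((spliceW n).card : ℝ) ≤ count 2 n := by exact_mod_cast card_spliceW_le n
  refine h1.trans ((KestenRate.count_le_envelope 2 n).trans ?_)
  exact mul_le_mul_of_nonneg_right (Real.exp_le_exp.2 (hwEnvelope_le (one_le_connectiveConstant 2) n))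
    (pow_nonneg (connectiveConstant_pos 2).le _)

/-- **Shifted super-multiplicativity of the spliced family at odd lengths** (`n, m ≥ 3` odd):
`|W_n| |W_m| ≤ (2(n+m+1)+3)^6 |W_{n+m+1}|` (polygon concatenation, Theorem 3.2.3 / (3.2.1)).
[cite: MadrasSlade1993, Theorem 3.2.3, eqs. (3.2.1)–(3.2.2)] -/
theorem spliceW_supermul (n m : ℕ) (hn : Odd n) (hm : Odd m) (h3n : 3 ≤ n) (h3m : 3 ≤ m) :
    ((spliceW n).card : ℝ) * (spliceW m).card ≤ (2 * ((n : ℝ) + m + 1) + 3) ^ 6 * (spliceW (n + m + 1)).card := by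
  have hnm : Odd (n + m + 1) := by
    obtain ⟨i, rfl⟩ := hn; obtain ⟨j, rfl⟩ := hm; exact ⟨i + j + 1, by ring⟩
  rw [spliceW_of_odd hn, spliceW_of_odd hm, spliceW_of_odd hnm, card_endWalks, card_endWalks, card_endWalks]
  have h := countAt_eDown_supermul (n := n) (m := m) (by omega) (by omega)
  have hb1 : 2 * (n + 1) + 1 ≤ 2 * (n + m + 1) + 3 := by omega
  have hb2 : 2 * (m + 1) + 1 ≤ 2 * (n + m + 1) + 3 := by omega
  have hb3 : 2 * (n + m + 2) + 1 ≤ 2 * (n + m + 1) + 3 := by omega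
  have h2 : (2 * (n + 1) + 1) ^ 2 * (2 * (m + 1) + 1) ^ 2 * (2 * (n + m + 2) + 1) ^ 2 ≤ (2 * (n + m + 1) + 3) ^ 6 := by
    calc (2 * (n + 1) + 1) ^ 2 * (2 * (m + 1) + 1) ^ 2 * (2 * (n + m + 2) + 1) ^ 2
        ≤ (2 * (n + m + 1) + 3) ^ 2 * (2 * (n + m + 1) + 3) ^ 2 * (2 * (n + m + 1) + 3) ^ 2 :=
          Nat.mul_le_mul (Nat.mul_le_mul (Nat.pow_le_pow_left hb1 2) (Nat.pow_le_pow_left hb2 2)) (Nat.pow_le_pow_left hb3 2)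
      _ = (2 * (n + m + 1) + 3) ^ 6 := by ring
  have h3 : countAt 2 n eDown * countAt 2 m eDown ≤ (2 * (n + m + 1) + 3) ^ 6 * countAt 2 (n + m + 1) eDown :=
    h.trans (Nat.mul_le_mul_right _ h2)
  have h4 : ((countAt 2 n eDown * countAt 2 m eDown : ℕ) : ℝ) ≤ (((2 * (n + m + 1) + 3) ^ 6 * countAt 2 (n + m + 1) eDown : ℕ) : ℝ) := by
    exact_mod_cast h3
  push_cast at h4
  convert h4 using 2

/-- **Lower rate** for the spliced ratio: `μ² − |W_{N+2}|/|W_N| ≤ K N^{-1/3}` at odd `N ≥ 1`.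
[cite: MadrasSlade1993, §7.5, eq. (7.5.2) (lower side, exponent 1/3)] -/
theorem rate_lower : ∃ K : ℝ, ∀ N : ℕ, 1 ≤ N → Odd N → ∀ u : ℝ, 0 < u →
    ((spliceW (N + 2)).card : ℝ) / (spliceW N).card ≤ connectiveConstant 2 ^ 2 - u →
      u ≤ K * (N : ℝ) ^ (-(1 : ℝ) / 3) := by
  obtain ⟨B, hB1, hBμ, hK⟩ := kesten_ineq_all
  obtain ⟨c, hc0, hlo⟩ := exp_mul_pow_le_card_spliceW
  have ha : ∀ n, (0 : ℝ) < (spliceW n).card := fun n => by exact_mod_cast card_spliceW_pos n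
  exact KestenRateLower.lower_rate_cubeRoot (a := fun n => ((spliceW n).card : ℝ)) ha (one_le_connectiveConstant 2)
    hB1 hBμ hc0 hK hlo spliceW_supermul

/-- **Upper rate** for the spliced ratio: `|W_{N+2}|/|W_N| − μ² ≤ K N^{-1/4}` at all `N ≥ 1`.
[cite: MadrasSlade1993, §7.5, eq. (7.5.2) (upper side, exponent 1/4)] -/
theorem rate_upper : ∃ K : ℝ, ∀ N : ℕ, 1 ≤ N → ∀ u : ℝ, 0 < u →
    connectiveConstant 2 ^ 2 + u ≤ ((spliceW (N + 2)).card : ℝ) / (spliceW N).card →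
      u ≤ K * (N : ℝ) ^ (-(1 : ℝ) / 4) := by
  obtain ⟨B, hB1, -, hK⟩ := kesten_ineq_all
  obtain ⟨c, hc0, hlo⟩ := exp_mul_pow_le_card_spliceW
  have ha : ∀ n, (0 : ℝ) < (spliceW n).card := fun n => by exact_mod_cast card_spliceW_pos n
  have hC : 0 ≤ 2 + Real.pi + Real.log (connectiveConstant 2) := by
    have := Real.log_nonneg (one_le_connectiveConstant 2); linarith [Real.pi_pos]
  exact KestenRateUpper.upper_rate_fourthRoot (a := fun n => ((spliceW n).card : ℝ)) ha (one_le_connectiveConstant 2)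
    hB1 hc0 hC hK hlo card_spliceW_le_exp

end EndpointRatio

open EndpointRatio in
/-- **Kesten's fixed-endpoint ratio rate (Madras–Slade (7.5.2)) on `ℤ²` for the four neighbours of the origin**:
for `x ∈ ℤ²` with `‖x‖₁ = 1` there are `K` and `N₀` (`= 1`) such that for all odd `N ≥ N₀`,
`-K N^{-1/3} ≤ c_{N+2}(0,x)/c_N(0,x) − μ² ≤ K N^{-1/4}`.  This is the case `d = 2`, `‖x‖₁ = 1` of the body of the tree's
named fact `Zd.Kesten1963_ratioRate_endpoint`.
[cite: MadrasSlade1993, §7.5 Notes, eq. (7.5.2) (p. 255); Theorem 7.3.4(b) (p. 248); Kesten1963SAW] -/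
theorem Kesten1963_ratioRate_neighbour_two : ∀ x : Site 2, normOne x = 1 → ∃ K : ℝ, ∃ N₀ : ℕ, ∀ N : ℕ, N₀ ≤ N →
    N % 2 = 1 →
      -(K * (N : ℝ) ^ (-(1 : ℝ) / 3)) ≤
          (countAt 2 (N + 2) x : ℝ) / countAt 2 N x - connectiveConstant 2 ^ 2 ∧
        (countAt 2 (N + 2) x : ℝ) / countAt 2 N x - connectiveConstant 2 ^ 2 ≤
          K * (N : ℝ) ^ (-(1 : ℝ) / 4) := by
  intro x hx
  obtain ⟨K₁, hK₁⟩ := rate_lower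
  obtain ⟨K₂, hK₂⟩ := rate_upper
  refine ⟨max (max K₁ K₂) 0, 1, fun N hN hpar => ?_⟩
  have hodd : Odd N := Nat.odd_iff.2 hpar
  have h2 : Odd (N + 2) := by obtain ⟨m, rfl⟩ := hodd; exact ⟨m + 1, by ring⟩
  rw [countAt_eq_countAt_eDown_of_normOne hx, countAt_eq_countAt_eDown_of_normOne hx, ← card_endWalks, ← card_endWalks,
    ← spliceW_of_odd hodd, ← spliceW_of_odd h2]
  set r : ℝ := ((spliceW (N + 2)).card : ℝ) / (spliceW N).card with hr
  have hN0 : (0 : ℝ) < N := by exact_mod_cast hN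
  have hp3 : 0 ≤ (N : ℝ) ^ (-(1 : ℝ) / 3) := Real.rpow_nonneg hN0.le _
  have hp4 : 0 ≤ (N : ℝ) ^ (-(1 : ℝ) / 4) := Real.rpow_nonneg hN0.le _
  have hKmax0 : 0 ≤ max (max K₁ K₂) 0 := le_max_right _ _
  constructor
  · rcases le_or_gt (connectiveConstant 2 ^ 2) r with h | h
    · have : 0 ≤ max (max K₁ K₂) 0 * (N : ℝ) ^ (-(1 : ℝ) / 3) := mul_nonneg hKmax0 hp3
      linarith
    · have hu := hK₁ N hN hodd (connectiveConstant 2 ^ 2 - r) (by linarith) (by rw [hr]; linarith)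
      have : K₁ * (N : ℝ) ^ (-(1 : ℝ) / 3) ≤ max (max K₁ K₂) 0 * (N : ℝ) ^ (-(1 : ℝ) / 3) :=
        mul_le_mul_of_nonneg_right (le_trans (le_max_left _ _) (le_max_left _ _)) hp3
      linarith
  · rcases le_or_gt r (connectiveConstant 2 ^ 2) with h | h
    · have : 0 ≤ max (max K₁ K₂) 0 * (N : ℝ) ^ (-(1 : ℝ) / 4) := mul_nonneg hKmax0 hp4
      linarith
    · have hu := hK₂ N hN (r - connectiveConstant 2 ^ 2) (by linarith) (by rw [hr]; linarith)
      have : K₂ * (N : ℝ) ^ (-(1 : ℝ) / 4) ≤ max (max K₁ K₂) 0 * (N : ℝ) ^ (-(1 : ℝ) / 4) :=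
        mul_le_mul_of_nonneg_right (le_trans (le_max_right _ _) (le_max_left _ _)) hp4
      linarith

end Literature.Probability.RandomPlanarGeometry.SAW.Zd
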